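import Summits.QuantumFields.BalabanUV.Beta.D1BFx.NeedleHLSGain

/-!
# `BalabanUV.Beta.D1BFx.NeedleNdlNdlLetters` — road «BF-x» for binder row D1, slot (K), END row `hGrp gN`, «GN-33 ∕ NN» LETTERS, PART 2: the three pairing
# letters of the `ndl ⊗ ndl` cell of T₃ over ABSTRACT needle-weighted profiles at `d = 4` — NEEDLE × LEG × NEEDLE (with PART 1's power gain),
# NEEDLE × LEG × FLAT (both placements), FLAT × LEG × FLAT

HONEST DEPENDENCY (cell records, verbatim): «continuum YM on T⁴ ⇐ BetaPertH ∧ nine spine estimates (0/9 proved); BetaPertH ⇐ (D1) ∧ (D4) ∧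
CAP+tail; G-an2-4 gates asym, D1 and NE2/3/4.»  HONEST FRAMING (cell contract, verbatim): «discharging `BetaPertH` makes Bałaban's UV stability
UNCONDITIONAL — a real constructive-QFT result; it is NOT the continuum limit and NOT the Clay problem.»  THIS MODULE DISCHARGES NOTHING of the
wall: [folklore] lattice bookkeeping over PART 1 (`NeedleHLSGain`) and leaf-04-g9's HLS kit (`LatticeHLS.sum_inv_nrm_pow_mul_le`,
`LatticeHLSDamped.abs_sum_mul_le_of_damped_profiles` ∕ `abs_sum_mul_le_of_damped_flat` ∕ `abs_applyK_le_of_damped_flat` ∕ `abs_pairing_le_of_damped_flat`) and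
the owner's `RankOneBubble.pairing` ∕ `applyK` ∕ `pairing_comm`; the leg `A`, the bond functions `ψ`, `χ`, `φ`, the needle index sets `N`, weights `q` and
centres `ctr` are ARBITRARY.  No `def`, no `def … : Prop`, nothing cited, nothing of Bałaban's asserted, 0 sorry.  Root-level binders hW ∕ hR-sockets ∕
hSX-socket ∕ D1Tel ∕ D1Rep — 0 discharged; (K) NOT closed; NOT D1, NOT `BetaPertH`, NOT continuum, NOT Clay.

ABSOLUTE RULE (cell charter, verbatim): «No internally-minted statement may enter as a cited fact. Every hypothesis is either kernel-proved in
this package or a verbatim quotation of a PUBLISHED theorem with page reference. The manuscript(s) under audit are NOT citable for their own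
disputed steps — they are the thing under adjudication; programme-internal (2001/route/tribunal) claims are never citable.»

WHY (owner claim table «GN-CELLS» = `HOME/b2b-balaban-beta-d1-p2/GLUON-NEEDLE-ROWS.md` v0.2, R3 cell `ndl ⊗ ndl`; an3-g57 `N36-SPLIT.v1.md` §3′ (4)
R3⊗R3 «`β = 𝔅(C,row′)𝔅(C′,row) − 𝔅(C,C′)𝔅(row,row′) − (transposes)`; `𝔅(C,row′) ≤ k·n^{λ′−3}`, `𝔅(C,C′) ≤ k·n⁴`, `𝔅(row,row′) ≤ …`»; MINE journal
2026-08-21 l.30734).  By `NeedleNdlShape.bubble_ndl_dSw` the `ndl ⊗ ndl` word is a signed sum of four products of pairings `pairing (grad f) (applyK Ga (grad g))`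
with `f, g ∈ {ρ = ndlRow, C = combined column}` of the two bonds.  The needle potential's gradient is a NEEDLE-WEIGHTED sum of damped Coulomb profiles
`Σ_{s} |qJet s|·(kP∕n²)·e^{−(dR∕2∕n)‖x−s‖}∕nrm(x−s)³` (`NeedlePotentialProfile.abs_ndlRow_diff_le_needle_profile`), the column gradient is FLAT `(C₀∕n)·e^{…}`
(`ProjectorColumnSharp.abs_combinedColumn_diff_le_sup`), the leg has the damped entry profile `kG·e^{−(δ∕n)‖x−y‖}∕nrm(x−y)²` (`GluonLegProfile.exists_abs_Ga_le_profile`).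
This file proves the three pairing shapes for such ABSTRACT data with the needle sums carried OUTSIDE every lattice sum, so that the cell author books them
by the bond marginal `NeedleBondMarginal.sum_bond_abs_qJet_le` at the w-sum.

CONTENT (`F` a finite fibre type; `C₄ := 4·2⁷·9³`; the kit brackets displayed verbatim).
* [folklore] **`abs_applyK_needle_le`** (leg × needle ⇒ needle-weighted damped profile of exponent 1, `(2,3) ↦ 1`),
  **`abs_pairing_needle_leg_needle_le`** (`≤ card F²·kA·B·B′·C₄·(217·29·(1+2∕ε))·Σ_{s,s′} q s·q′ s′∕nrm(ctr s − ctr′ s′)`),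
  **`abs_pairing_needle_leg_flat_le`** (needle outside: `≤ …·Σ_s q s·e^{−(ε∕4)‖ctr s − u‖}`), **`abs_pairing_flat_leg_needle_le`** (needle inside:
  `≤ …·Σ_s q s·e^{−(ε∕2)‖ctr s − u‖}`), **`abs_pairing_flat_leg_flat_le`** (`≤ …·e^{−(ε∕4)‖u−v‖}`).
NOT HERE (honest): the instantiation at `Ga`, `ndlRow`, the combined column; the census; the cell — `NeedleNdlNdlPairings` ∕ `NeedleNdlNdlRow`.
Unit `b2b-balaban-gan24-formalise-leaf-05` (gen 42), G-an2-4 swarm leaf prover on cross-lane kernel duty; `LEAVES-BFx.md` row (N) «GN-33∕NN».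
-/

namespace Summit.QuantumFields.BalabanUV.Beta.D1BFx.NeedleNdlNdlLetters

open Finset
open scoped BigOperators
open Literature.MathematicalPhysics.QuantumFieldTheory.Balaban1983to89.Beta
open ExpKernelCalculus (Site MKer)
open PoissonInterior (supNorm nrm nrm_pos nrm_neg supNorm_neg)
open LatticeHLSDamped (abs_sum_mul_le_of_damped_profiles abs_sum_mul_le_of_damped_flat abs_applyK_le_of_damped_flat)
open RankOneBubble (pairing applyK pairing_def applyK_apply)
open NeedleHLSGain (sum_exp_div_nrm_pow_mul_nrm_le abs_applyK_le_of_needle abs_pairing_le_of_needle_left abs_pairing_le_of_needle_needle)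

variable {F : Type*} [Fintype F]

/-! ## §3 The letters at `d = 4` -/

section Four

variable {A : MKer 4 F}

/-- [folklore] **LEG × NEEDLE ⇒ NEEDLE-WEIGHTED DAMPED PROFILE OF EXPONENT 1** (`(2,3) ↦ 1`): a damped Coulomb entry profile of the leg
`|A x y c e| ≤ kA·e^{−ε‖x−y‖}∕nrm(x−y)²` and a needle-weighted cubic profile `|φ y e| ≤ Σ_{s∈N} q s·(B·e^{−ε‖y−ctr s‖}∕nrm(y−ctr s)³)` give
`|applyK A φ x c| ≤ Σ_{s∈N} q s·(card F·kA·B·C₄·e^{−ε‖x−ctr s‖}∕nrm(x−ctr s))` at every `x`, `c` (`C₄ = 4·2⁷·9³`). -/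
theorem abs_applyK_needle_le {ι : Type*} {φ : Site 4 → F → ℝ} (N : Finset ι) {q : ι → ℝ} (hq : ∀ s ∈ N, 0 ≤ q s) {kA B ε : ℝ}
    (hkA : 0 ≤ kA) (hB : 0 ≤ B) (hε : 0 ≤ ε) (ctr : ι → Site 4)
    (hA : ∀ x y c e, |A x y c e| ≤ kA * Real.exp (-ε * supNorm (x - y)) / nrm (x - y) ^ 2)
    (hφ : ∀ y e, |φ y e| ≤ ∑ s ∈ N, q s * (B * Real.exp (-ε * supNorm (y - ctr s)) / nrm (y - ctr s) ^ 3)) (x : Site 4) (c : F) :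
    |applyK A φ x c| ≤ ∑ s ∈ N, q s *
      (Fintype.card F * kA * B * (4 * 2 ^ (4 + 3) * 9 ^ (4 - 1)) * Real.exp (-ε * supNorm (x - ctr s)) / nrm (x - ctr s)) := by
  have h := abs_applyK_le_of_needle (d := 4) N hq (a := fun y => kA * Real.exp (-ε * supNorm (y - x)) / nrm (y - x) ^ 2)
    (fun y => by have := nrm_pos (y - x); positivity)
    (g := fun s y => B * Real.exp (-ε * supNorm (y - ctr s)) / nrm (y - ctr s) ^ 3)
    (G := fun s => kA * B * ((4 : ℕ) * 2 ^ (4 + 3) * 9 ^ (4 - 1)) * Real.exp (-ε * supNorm (x - ctr s)) / nrm (x - ctr s) ^ (2 + 3 - 4))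
    x c (fun y e => by rw [← nrm_neg, neg_sub, ← supNorm_neg, neg_sub]; exact hA x y c e) hφ
    (fun s _ T => by
      have h1 := abs_sum_mul_le_of_damped_profiles (d := 4) (by norm_num) (a := 2) (b := 3) (by norm_num) (by norm_num) (by norm_num)
        hkA hB hε T x (ctr s) (K := fun y => kA * Real.exp (-ε * supNorm (y - x)) / nrm (y - x) ^ 2)
        (f := fun y => B * Real.exp (-ε * supNorm (y - ctr s)) / nrm (y - ctr s) ^ 3)
        (fun y _ => by rw [abs_of_nonneg (by have := nrm_pos (y - x); positivity)])
        (fun y _ => by rw [abs_of_nonneg (by have := nrm_pos (y - ctr s); positivity)])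
      refine le_trans (le_of_eq ?_) h1
      exact Finset.sum_congr rfl fun y _ => by
        rw [abs_of_nonneg (by have := nrm_pos (y - x); have := nrm_pos (y - ctr s); positivity)])
  refine h.trans (le_of_eq ?_)
  rw [Finset.mul_sum]
  refine Finset.sum_congr rfl fun s _ => ?_
  have e1 : (2 + 3 - 4 : ℕ) = 1 := by norm_num
  rw [e1, pow_one]
  push_cast
  ring

/-- [folklore] **NEEDLE × LEG × NEEDLE — THE `𝔅(row, row′)` LETTER WITH THE POWER GAIN** (`d = 4`, `ε > 0`): a damped Coulomb leg and two
needle-weighted cubic profiles give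
`|pairing ψ (applyK A χ)| ≤ card F²·kA·B·B′·C₄·((1+2·4·3³)(2+3³)(1+2∕ε))·Σ_{s∈N} Σ_{s′∈N′} q s·q′ s′∕nrm(ctr s − ctr′ s′)`
(leg × right needle by `abs_applyK_needle_le`, then §1 per pair of needle sites, the left damping dropped). -/
theorem abs_pairing_needle_leg_needle_le {ι ι' : Type*} {ψ χ : Site 4 → F → ℝ} (N : Finset ι) (N' : Finset ι') {q : ι → ℝ}
    {q' : ι' → ℝ} (hq : ∀ s ∈ N, 0 ≤ q s) (hq' : ∀ s' ∈ N', 0 ≤ q' s') {kA B B' ε : ℝ} (hkA : 0 ≤ kA) (hB : 0 ≤ B) (hB' : 0 ≤ B')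
    (hε : 0 < ε) (ctr : ι → Site 4) (ctr' : ι' → Site 4)
    (hA : ∀ x y c e, |A x y c e| ≤ kA * Real.exp (-ε * supNorm (x - y)) / nrm (x - y) ^ 2)
    (hψ : ∀ x c, |ψ x c| ≤ ∑ s ∈ N, q s * (B * Real.exp (-ε * supNorm (x - ctr s)) / nrm (x - ctr s) ^ 3))
    (hχ : ∀ x c, |χ x c| ≤ ∑ s' ∈ N', q' s' * (B' * Real.exp (-ε * supNorm (x - ctr' s')) / nrm (x - ctr' s') ^ 3)) :
    |pairing ψ (applyK A χ)| ≤ Fintype.card F * (Fintype.card F * kA * B * B' * (4 * 2 ^ (4 + 3) * 9 ^ (4 - 1)) *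
      ((1 + 2 * 4 * 3 ^ (4 - 1)) * (2 + 3 ^ (4 - 1)) * (1 + 2 / ε))) * ∑ s ∈ N, ∑ s' ∈ N', q s * q' s' / nrm (ctr s - ctr' s') := by
  set C₄ : ℝ := 4 * 2 ^ (4 + 3) * 9 ^ (4 - 1) with hC₄
  set cg : ℝ := (1 + 2 * 4 * 3 ^ (4 - 1)) * (2 + 3 ^ (4 - 1)) * (1 + 2 / ε) with hcg
  have hAχ := abs_applyK_needle_le (A := A) N' hq' hkA hB' hε.le ctr' hA hχ
  have h := abs_pairing_le_of_needle_needle (d := 4) (F := F) N N' hq hq'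
    (g := fun s x => B * Real.exp (-ε * supNorm (x - ctr s)) / nrm (x - ctr s) ^ 3)
    (g' := fun s' x => Fintype.card F * kA * B' * C₄ * Real.exp (-ε * supNorm (x - ctr' s')) / nrm (x - ctr' s'))
    (fun s' _ x => by have := nrm_pos (x - ctr' s'); positivity)
    (G := fun s s' => B * (Fintype.card F * kA * B' * C₄) * (cg / nrm (ctr s - ctr' s'))) hψ (fun x c => hAχ x c) ?_
  · refine h.2.trans (le_of_eq ?_)
    rw [Finset.mul_sum, Finset.mul_sum]
    refine Finset.sum_congr rfl fun s _ => ?_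
    rw [Finset.mul_sum, Finset.mul_sum]
    refine Finset.sum_congr rfl fun s' _ => ?_
    rw [hcg]; ring
  · intro s _ s' _ S
    have hgain := sum_exp_div_nrm_pow_mul_nrm_le (d := 4) (by norm_num) hε S (ctr s) (ctr' s')
    have hpt : ∀ x ∈ S, B * Real.exp (-ε * supNorm (x - ctr s)) / nrm (x - ctr s) ^ 3 *
        (Fintype.card F * kA * B' * C₄ * Real.exp (-ε * supNorm (x - ctr' s')) / nrm (x - ctr' s'))
        ≤ B * (Fintype.card F * kA * B' * C₄) * (Real.exp (-ε * supNorm (x - ctr s)) / (nrm (x - ctr s) ^ (4 - 1) * nrm (x - ctr' s'))) := by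
      intro x _
      have h1 := nrm_pos (x - ctr s); have h2 := nrm_pos (x - ctr' s')
      have hle : Real.exp (-ε * supNorm (x - ctr' s')) ≤ 1 := by
        rw [Real.exp_le_one_iff]; have : (0 : ℝ) ≤ ε * supNorm (x - ctr' s') := by positivity
        linarith
      have e3 : (4 - 1 : ℕ) = 3 := by norm_num
      rw [e3]
      calc B * Real.exp (-ε * supNorm (x - ctr s)) / nrm (x - ctr s) ^ 3 *
            (Fintype.card F * kA * B' * C₄ * Real.exp (-ε * supNorm (x - ctr' s')) / nrm (x - ctr' s'))
          = B * (Fintype.card F * kA * B' * C₄) * (Real.exp (-ε * supNorm (x - ctr s)) / (nrm (x - ctr s) ^ 3 * nrm (x - ctr' s'))) *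
              Real.exp (-ε * supNorm (x - ctr' s')) := by field_simp
        _ ≤ B * (Fintype.card F * kA * B' * C₄) * (Real.exp (-ε * supNorm (x - ctr s)) / (nrm (x - ctr s) ^ 3 * nrm (x - ctr' s'))) * 1 :=
            mul_le_mul_of_nonneg_left hle (by positivity)
        _ = _ := by rw [mul_one]
    calc ∑ x ∈ S, B * Real.exp (-ε * supNorm (x - ctr s)) / nrm (x - ctr s) ^ 3 *
          (Fintype.card F * kA * B' * C₄ * Real.exp (-ε * supNorm (x - ctr' s')) / nrm (x - ctr' s'))
        ≤ ∑ x ∈ S, B * (Fintype.card F * kA * B' * C₄) * (Real.exp (-ε * supNorm (x - ctr s)) / (nrm (x - ctr s) ^ (4 - 1) * nrm (x - ctr' s'))) :=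
          Finset.sum_le_sum hpt
      _ = B * (Fintype.card F * kA * B' * C₄) * ∑ x ∈ S, Real.exp (-ε * supNorm (x - ctr s)) / (nrm (x - ctr s) ^ (4 - 1) * nrm (x - ctr' s')) := by
          rw [Finset.mul_sum]
      _ ≤ B * (Fintype.card F * kA * B' * C₄) * (cg / nrm (ctr s - ctr' s')) := by
          rw [hcg]; exact mul_le_mul_of_nonneg_left hgain (by positivity)

/-- [folklore] **NEEDLE × LEG × FLAT, the needle OUTSIDE** (`d = 4`, `ε > 0`): damped Coulomb leg, needle-weighted cubic profile `ψ`, flat damped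
`|χ x c| ≤ Bf·e^{−ε‖x−u‖}` ⟹
`|pairing ψ (applyK A χ)| ≤ card F²·kA·B·Bf·(1 + 216·(4∕ε)(1+4∕ε))·(1 + 216·(1+8∕ε))·Σ_{s∈N} q s·e^{−(ε∕4)‖ctr s − u‖}`
(leg × flat by the kit's `abs_applyK_le_of_damped_flat` at exponent 2 — a flat damped bond function of rate `ε∕2` —, then `abs_sum_mul_le_of_damped_flat`
at exponent 3 per needle site). -/
theorem abs_pairing_needle_leg_flat_le {ι : Type*} {ψ χ : Site 4 → F → ℝ} (N : Finset ι) {q : ι → ℝ} (hq : ∀ s ∈ N, 0 ≤ q s)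
    {kA B Bf ε : ℝ} (hkA : 0 ≤ kA) (hB : 0 ≤ B) (hBf : 0 ≤ Bf) (hε : 0 < ε) (ctr : ι → Site 4) (u : Site 4)
    (hA : ∀ x y c e, |A x y c e| ≤ kA * Real.exp (-ε * supNorm (x - y)) / nrm (x - y) ^ 2)
    (hψ : ∀ x c, |ψ x c| ≤ ∑ s ∈ N, q s * (B * Real.exp (-ε * supNorm (x - ctr s)) / nrm (x - ctr s) ^ 3))
    (hχ : ∀ x c, |χ x c| ≤ Bf * Real.exp (-ε * supNorm (x - u))) :
    |pairing ψ (applyK A χ)| ≤ Fintype.card F * (Fintype.card F * kA * Bf * B *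
      (1 + 2 * 4 * 3 ^ (4 - 1) * ((4 - 1 - 2).factorial * (2 / (ε / 2)) ^ (4 - 1 - 2) * (1 + 2 / (ε / 2)))) *
      (1 + 2 * 4 * 3 ^ (4 - 1) * ((4 - 1 - 3).factorial * (2 / (ε / 2 / 2)) ^ (4 - 1 - 3) * (1 + 2 / (ε / 2 / 2))))) *
      ∑ s ∈ N, q s * Real.exp (-(ε / 2 / 2) * supNorm (ctr s - u)) := by
  set c2 : ℝ := 1 + 2 * 4 * 3 ^ (4 - 1) * ((4 - 1 - 2).factorial * (2 / (ε / 2)) ^ (4 - 1 - 2) * (1 + 2 / (ε / 2))) with hc2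
  set c3 : ℝ := 1 + 2 * 4 * 3 ^ (4 - 1) * ((4 - 1 - 3).factorial * (2 / (ε / 2 / 2)) ^ (4 - 1 - 3) * (1 + 2 / (ε / 2 / 2))) with hc3
  have hc2_0 : 0 ≤ c2 := by positivity
  -- step 1: the leg on the flat factor
  have hAχ : ∀ x c, |applyK A χ x c| ≤ Fintype.card F * kA * Bf * Real.exp (-(ε / 2) * supNorm (x - u)) * c2 :=
    fun x c => abs_applyK_le_of_damped_flat (d := 4) (by norm_num) (a := 2) (by norm_num) hkA hBf hε u hA hχ x c
  -- step 2: the needle outside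
  have h := abs_pairing_le_of_needle_left (d := 4) (F := F) N hq
    (g := fun s x => B * Real.exp (-ε * supNorm (x - ctr s)) / nrm (x - ctr s) ^ 3)
    (h := fun x => Fintype.card F * kA * Bf * Real.exp (-(ε / 2) * supNorm (x - u)) * c2)
    (G := fun s => B * (Fintype.card F * kA * Bf * c2) * Real.exp (-(ε / 2 / 2) * supNorm (ctr s - u)) * c3) hψ hAχ ?_
  · refine h.2.trans (le_of_eq ?_)
    rw [Finset.mul_sum, Finset.mul_sum]
    exact Finset.sum_congr rfl fun s _ => by ring
  · intro s _ S
    have h1 := abs_sum_mul_le_of_damped_flat (d := 4) (by norm_num) (a := 3) (by norm_num) hB (by positivity : 0 ≤ Fintype.card F * kA * Bf * c2)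
      (half_pos hε) S (ctr s) u (K := fun x => B * Real.exp (-ε * supNorm (x - ctr s)) / nrm (x - ctr s) ^ 3)
      (f := fun x => Fintype.card F * kA * Bf * Real.exp (-(ε / 2) * supNorm (x - u)) * c2)
      (fun x _ => by
        have hn := nrm_pos (x - ctr s)
        rw [abs_of_nonneg (by positivity)]
        refine div_le_div_of_nonneg_right (mul_le_mul_of_nonneg_left (Real.exp_le_exp.2 ?_) hB) (by positivity)
        have : (0 : ℝ) ≤ ε / 2 * supNorm (x - ctr s) := by positivity
        nlinarith)
      (fun x _ => by rw [abs_of_nonneg (by positivity)]; exact le_of_eq (by ring))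
    refine le_trans (le_of_eq ?_) (h1.trans (le_of_eq ?_))
    · exact Finset.sum_congr rfl fun x _ => by rw [abs_of_nonneg (by have := nrm_pos (x - ctr s); positivity)]
    · rw [hc3]; push_cast; ring

/-- [folklore] **FLAT × LEG × NEEDLE, the needle INSIDE** (`d = 4`, `ε > 0`): flat damped `|ψ x c| ≤ Bf·e^{−ε‖x−u‖}` outside, the leg on a
needle-weighted cubic profile inside ⟹
`|pairing ψ (applyK A φ)| ≤ card F²·kA·B·Bf·C₄·(1 + 216·(2!(4∕ε)²(1+4∕ε)))·Σ_{s∈N} q s·e^{−(ε∕2)‖u − ctr s‖}`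
(`abs_applyK_needle_le`, then `abs_sum_mul_le_of_damped_flat` at exponent 1 per needle site). -/
theorem abs_pairing_flat_leg_needle_le {ι : Type*} {ψ φ : Site 4 → F → ℝ} (N : Finset ι) {q : ι → ℝ} (hq : ∀ s ∈ N, 0 ≤ q s)
    {kA B Bf ε : ℝ} (hkA : 0 ≤ kA) (hB : 0 ≤ B) (hBf : 0 ≤ Bf) (hε : 0 < ε) (ctr : ι → Site 4) (u : Site 4)
    (hA : ∀ x y c e, |A x y c e| ≤ kA * Real.exp (-ε * supNorm (x - y)) / nrm (x - y) ^ 2)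
    (hψ : ∀ x c, |ψ x c| ≤ Bf * Real.exp (-ε * supNorm (x - u)))
    (hφ : ∀ y e, |φ y e| ≤ ∑ s ∈ N, q s * (B * Real.exp (-ε * supNorm (y - ctr s)) / nrm (y - ctr s) ^ 3)) :
    |pairing ψ (applyK A φ)| ≤ Fintype.card F * (Fintype.card F * kA * B * (4 * 2 ^ (4 + 3) * 9 ^ (4 - 1)) * Bf *
      (1 + 2 * 4 * 3 ^ (4 - 1) * ((4 - 1 - 1).factorial * (2 / (ε / 2)) ^ (4 - 1 - 1) * (1 + 2 / (ε / 2))))) *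
      ∑ s ∈ N, q s * Real.exp (-(ε / 2) * supNorm (ctr s - u)) := by
  set C₄ : ℝ := 4 * 2 ^ (4 + 3) * 9 ^ (4 - 1) with hC₄
  set c1 : ℝ := 1 + 2 * 4 * 3 ^ (4 - 1) * ((4 - 1 - 1).factorial * (2 / (ε / 2)) ^ (4 - 1 - 1) * (1 + 2 / (ε / 2))) with hc1
  have hAφ := abs_applyK_needle_le (A := A) N hq hkA hB hε.le ctr hA hφ
  -- the pairing with the needle sum on the RIGHT: swap the factors (`pairing` is symmetric)
  rw [RankOneBubble.pairing_comm]
  have h := abs_pairing_le_of_needle_left (d := 4) (F := F) N hq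
    (g := fun s x => Fintype.card F * kA * B * C₄ * Real.exp (-ε * supNorm (x - ctr s)) / nrm (x - ctr s))
    (h := fun x => Bf * Real.exp (-ε * supNorm (x - u)))
    (G := fun s => Fintype.card F * kA * B * C₄ * Bf * Real.exp (-(ε / 2) * supNorm (ctr s - u)) * c1) (fun x c => hAφ x c) hψ ?_
  · refine h.2.trans (le_of_eq ?_)
    rw [Finset.mul_sum, Finset.mul_sum]
    exact Finset.sum_congr rfl fun s _ => by ring
  · intro s _ S
    have h1 := abs_sum_mul_le_of_damped_flat (d := 4) (by norm_num) (a := 1) (by norm_num)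
      (by positivity : 0 ≤ Fintype.card F * kA * B * C₄) hBf hε S (ctr s) u
      (K := fun x => Fintype.card F * kA * B * C₄ * Real.exp (-ε * supNorm (x - ctr s)) / nrm (x - ctr s))
      (f := fun x => Bf * Real.exp (-ε * supNorm (x - u)))
      (fun x _ => by rw [abs_of_nonneg (by have := nrm_pos (x - ctr s); positivity), pow_one])
      (fun x _ => by rw [abs_of_nonneg (by positivity)])
    refine le_trans (le_of_eq ?_) (h1.trans (le_of_eq ?_))
    · exact Finset.sum_congr rfl fun x _ => by rw [abs_of_nonneg (by have := nrm_pos (x - ctr s); positivity)]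
    · rw [hc1]; push_cast; ring

/-- [folklore] **FLAT × LEG × FLAT — THE `𝔅(C, C′)` LETTER** (`d = 4`, `ε > 0`): `|ψ x c| ≤ Bp·e^{−ε‖x−u‖}`, `|χ x c| ≤ Bu·e^{−ε‖x−v‖}` ⟹
`|pairing ψ (applyK A χ)| ≤ card F²·kA·Bp·Bu·(1 + 216·(4∕ε)(1+4∕ε))·(1 + 216·(3!(8∕ε)³(1+8∕ε)))·e^{−(ε∕4)‖u−v‖}` (leg × flat by
`abs_applyK_le_of_damped_flat`, then the kit's flat × flat damped sum at rate `ε∕2`). -/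
theorem abs_pairing_flat_leg_flat_le {ψ χ : Site 4 → F → ℝ} {kA Bp Bu ε : ℝ} (hkA : 0 ≤ kA) (hBp : 0 ≤ Bp) (hBu : 0 ≤ Bu) (hε : 0 < ε)
    (u v : Site 4) (hA : ∀ x y c e, |A x y c e| ≤ kA * Real.exp (-ε * supNorm (x - y)) / nrm (x - y) ^ 2)
    (hψ : ∀ x c, |ψ x c| ≤ Bp * Real.exp (-ε * supNorm (x - u))) (hχ : ∀ x c, |χ x c| ≤ Bu * Real.exp (-ε * supNorm (x - v))) :
    |pairing ψ (applyK A χ)| ≤ Fintype.card F * Bp * (Fintype.card F * kA * Bu *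
      (1 + 2 * 4 * 3 ^ (4 - 1) * ((4 - 1 - 2).factorial * (2 / (ε / 2)) ^ (4 - 1 - 2) * (1 + 2 / (ε / 2))))) *
      Real.exp (-(ε / 2 / 2) * supNorm (u - v)) *
      (1 + 2 * 4 * 3 ^ (4 - 1) * ((4 - 1 - 0).factorial * (2 / (ε / 2 / 2)) ^ (4 - 1 - 0) * (1 + 2 / (ε / 2 / 2)))) := by
  set c2 : ℝ := 1 + 2 * 4 * 3 ^ (4 - 1) * ((4 - 1 - 2).factorial * (2 / (ε / 2)) ^ (4 - 1 - 2) * (1 + 2 / (ε / 2))) with hc2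
  have hAχ : ∀ x c, |applyK A χ x c| ≤ Fintype.card F * kA * Bu * Real.exp (-(ε / 2) * supNorm (x - v)) * c2 :=
    fun x c => abs_applyK_le_of_damped_flat (d := 4) (by norm_num) (a := 2) (by norm_num) hkA hBu hε v hA hχ x c
  have hψ' : ∀ x c, |ψ x c| ≤ Bp * Real.exp (-(ε / 2) * supNorm (x - u)) / nrm (x - u) ^ 0 := by
    intro x c
    rw [pow_zero, div_one]
    refine (hψ x c).trans (mul_le_mul_of_nonneg_left (Real.exp_le_exp.2 ?_) hBp)
    have : (0 : ℝ) ≤ ε / 2 * supNorm (x - u) := by positivity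
    nlinarith
  have h := LatticeHLSDamped.abs_pairing_le_of_damped_flat (d := 4) (by norm_num) (a := 0) (by norm_num) hBp
    (by positivity : 0 ≤ Fintype.card F * kA * Bu * c2) (half_pos hε) u v hψ' (fun x c => (hAχ x c).trans (le_of_eq (by ring)))
  exact h.2

end Four

end Summit.QuantumFields.BalabanUV.Beta.D1BFx.NeedleNdlNdlLetters
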